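import Literature.AlgebraicGeometry.ComplexMultiplication.GenericCMFieldSameFieldFamiliesHodge
import HarnessLib

/-!
# Four pairwise inequivalent CM types of ONE sextic CM field satisfy a sign relation `Σ_i η_i u_{Φ_i} = 0`

COR-CM (cell `pub-hodgecm2`), seat p2 gen 21; count-neutral; theorems only, no definition, no named fact, no `sorry`.
Part 1 of 2 (sequel: `CorCM/SexticCMFourTypesExceptionalClass` — the explicit exceptional `(2,2)`-class on
`X₀ × X₁ × X₂ × X₃`).  For a CM type `Φ` of `K` write `u_Φ = 𝟙_Φ − 𝟙_Φ̄ : Hom(K, ℂ) → {±1}` (`antiVec Φ.1 1`).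

* `sum_mul_eq_zero_of_sign` — four pairwise distinct, pairwise non-opposite vectors `(x_i, y_i, z_i) ∈ {±1}³` satisfy
  `Σ_i x_i y_i = 0` (the four pairs `(x_i z_i, y_i z_i)` are pairwise distinct, hence exhaust `{±1}²`);
* `two_mul_ncard_cmType` (`2 · #Φ = [K:ℚ]`), `conjugate_mem_of_not_mem`, `eq_of_eqOn_cmType` (odd functions agreeing
  on a CM type agree);
* **`exists_sign_relation_of_finrank_eq_six`** — for ANY sextic CM field `K` and any four CM types with
  `u_{Φ_j} ≠ ±u_{Φ_i}` (`i ≠ j`): `Σ_i η_i u_{Φ_i} = 0` with `η_i = u_{Φ_i}(s₀) u_{Φ_i}(s₁) u_{Φ_i}(s₂) ∈ {±1}` for a CM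
  type `{s₀, s₁, s₂}` of `K` (at `s_k` the relation is `Σ_i u_{Φ_i}(s_a) u_{Φ_i}(s_b) = 0`, at `s̄_k` it follows by
  oddness).

Provenance: Literature home (namespace `Literature.AlgebraicGeometry.ComplexMultiplication.GenericCMField`) of the Summits-side `CorCM/SexticCMFourTypesSignRelation` (cell `pub-hodgecm2`, COR-CM; all its imports are `Literature/`, Mathlib and the already re-homed `GenericCMFieldSameFieldFamiliesHodge`), which `Literature/` may not import; theorems only, no named fact, no definition. Nothing here bears on `HC_CM`. Lane `lit-hodgefound` (Layer A3: CM types, their Kubota ranks and Galois combinatorics), seat p20.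
-/

noncomputable section

open _root_.CategoryTheory _root_.CategoryTheory.Limits NumberField NumberField.ComplexEmbedding
open scoped BigOperators

namespace Literature.AlgebraicGeometry.ComplexMultiplication.GenericCMField

open Literature.NumberTheory.ComplexMultiplication
open Literature.AlgebraicGeometry.Motives (AbelianVariety CMType)
open Literature.AlgebraicGeometry.HodgeTheory
open Literature.AlgebraicGeometry.ComplexMultiplication (IsCMTypeRealisation)
open Literature.AlgebraicGeometry.VanGeemen1994 (hodgeClassSpan)
open Literature.AlgebraicGeometry.Pohlmann1968
open Literature.Barriers.HodgeConjecture (divisorClassesSpan)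

/-! ## §1 Sign arithmetic: four pairwise inequivalent vectors of `{±1}³` -/

section Sign

/-- **Four pairwise distinct, pairwise non-opposite vectors `(x_i, y_i, z_i) ∈ {±1}³` satisfy `Σ_i x_i y_i = 0`**: the
four pairs `(x_i z_i, y_i z_i) ∈ {±1}²` are pairwise distinct, hence all of `{±1}²`, and `x_i y_i = (x_i z_i)(y_i z_i)`. [cite: Dodson1984, §3.2 and Thm. 3.3] -/
theorem sum_mul_eq_zero_of_sign (x y z : Fin 4 → ℚ) (hx : ∀ i, x i = 1 ∨ x i = -1) (hy : ∀ i, y i = 1 ∨ y i = -1)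
    (hz : ∀ i, z i = 1 ∨ z i = -1)
    (hne : ∀ i j, i ≠ j → ¬(x j = x i ∧ y j = y i ∧ z j = z i) ∧ ¬(x j = -x i ∧ y j = -y i ∧ z j = -z i)) :
    ∑ i, x i * y i = 0 := by
  classical
  let g : Fin 4 → ℚ × ℚ := fun i => (x i * z i, y i * z i)
  have hzz : ∀ i, z i * z i = 1 := fun i => by rcases hz i with h | h <;> rw [h] <;> norm_num
  have hginj : Function.Injective g := by
    intro i j hij
    by_contra hne'
    simp only [g, Prod.mk.injEq] at hij
    obtain ⟨h1, h2⟩ := hij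
    rcases hz i with hi | hi <;> rcases hz j with hj | hj
    · refine (hne j i (Ne.symm hne')).1 ⟨?_, ?_, by rw [hi, hj]⟩ <;> [have := h1; have := h2] <;>
        rw [hi, hj] at this <;> linarith
    · refine (hne j i (Ne.symm hne')).2 ⟨?_, ?_, by rw [hi, hj]; norm_num⟩ <;> [have := h1; have := h2] <;>
        rw [hi, hj] at this <;> linarith
    · refine (hne j i (Ne.symm hne')).2 ⟨?_, ?_, by rw [hi, hj]⟩ <;> [have := h1; have := h2] <;>
        rw [hi, hj] at this <;> linarith
    · refine (hne j i (Ne.symm hne')).1 ⟨?_, ?_, by rw [hi, hj]⟩ <;> [have := h1; have := h2] <;>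
        rw [hi, hj] at this <;> linarith
  let P : Finset (ℚ × ℚ) := {(1, 1), (1, -1), (-1, 1), (-1, -1)}
  have hsub : Finset.univ.image g ⊆ P := by
    intro p hp
    obtain ⟨i, -, rfl⟩ := Finset.mem_image.1 hp
    simp only [g, P, Finset.mem_insert, Finset.mem_singleton, Prod.mk.injEq]
    rcases hx i with h1 | h1 <;> rcases hy i with h2 | h2 <;> rcases hz i with h3 | h3 <;>
      simp [h1, h2, h3]
  have hcardP : P.card ≤ (Finset.univ.image g).card := by
    rw [Finset.card_image_of_injective _ hginj, Finset.card_univ, Fintype.card_fin]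
    exact Finset.card_le_four
  have himg : Finset.univ.image g = P := Finset.eq_of_subset_of_card_le hsub hcardP
  have hxy : ∀ i, x i * y i = (g i).1 * (g i).2 := fun i => by
    simp only [g]
    calc x i * y i = x i * y i * (z i * z i) := by rw [hzz i, mul_one]
      _ = x i * z i * (y i * z i) := by ring
  calc ∑ i, x i * y i = ∑ i, (fun p : ℚ × ℚ => p.1 * p.2) (g i) := Finset.sum_congr rfl fun i _ => hxy i
    _ = ∑ p ∈ Finset.univ.image g, p.1 * p.2 :=
        (Finset.sum_image (f := fun p : ℚ × ℚ => p.1 * p.2) (s := Finset.univ) (g := g)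
          fun i _ j _ h => hginj h).symm
    _ = 0 := by rw [himg]; simp [P]; norm_num

variable {K : Type} [Field K] [NumberField K] [IsCMField K]

omit [NumberField K] [IsCMField K] in
/-- If `s ∉ Φ` then `s̄ ∈ Φ`. [cite: Dodson1984, §3.2 and Thm. 3.3] -/
theorem conjugate_mem_of_not_mem (Φ : CMType K) {s : K →+* ℂ} (hs : s ∉ Φ.1) : conjugate s ∈ Φ.1 :=
  (Φ.2 (conjugate s)).2 (by rw [show conjugate (conjugate s) = s from ComplexEmbedding.involutive_conjugate K s]; exact hs)

omit [NumberField K] [IsCMField K] in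
/-- Two conjugation-odd functions on `Hom(K, ℂ)` agreeing on a CM type agree. [cite: Dodson1984, §3.2 and Thm. 3.3] -/
theorem eq_of_eqOn_cmType (Φ : CMType K) {f g : (K →+* ℂ) → ℚ} (hf : ∀ s, f (conjugate s) = -f s)
    (hg : ∀ s, g (conjugate s) = -g s) (h : ∀ s ∈ Φ.1, f s = g s) (s : K →+* ℂ) : f s = g s := by
  by_cases hs : s ∈ Φ.1
  · exact h s hs
  · have := h (conjugate s) (conjugate_mem_of_not_mem Φ hs)
    rw [hf, hg] at this
    linarith

omit [IsCMField K] in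
open scoped Classical in
/-- A CM type of a field of degree `2n` has `n` elements: `2 · #Φ = [K:ℚ]`. [cite: Dodson1984, §3.2 and Thm. 3.3] -/
theorem two_mul_ncard_cmType (Φ : CMType K) : 2 * Φ.1.ncard = Module.finrank ℚ K := by
  have hS : Φ.1.ncard = (Finset.univ.filter fun s : K →+* ℂ => s ∈ Φ.1).card := by
    rw [← Set.ncard_coe_finset]; congr 1; ext s; simp
  have hbij : (Finset.univ.filter fun s : K →+* ℂ => s ∈ Φ.1).card =
      (Finset.univ.filter fun s : K →+* ℂ => s ∉ Φ.1).card := by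
    refine Finset.card_nbij' (fun s => conjugate s) (fun s => conjugate s) ?_ ?_ ?_ ?_
    · intro s hs
      simp only [Finset.mem_coe, Finset.mem_filter, Finset.mem_univ, true_and] at hs ⊢
      exact (Φ.2 s).1 hs
    · intro s hs
      simp only [Finset.mem_coe, Finset.mem_filter, Finset.mem_univ, true_and] at hs ⊢
      exact conjugate_mem_of_not_mem Φ hs
    · intro s _; exact ComplexEmbedding.involutive_conjugate K s
    · intro s _; exact ComplexEmbedding.involutive_conjugate K s
  have hsum := Finset.card_filter_add_card_filter_not (s := (Finset.univ : Finset (K →+* ℂ))) (fun s => s ∈ Φ.1)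
  rw [Finset.card_univ, Embeddings.card, ← hbij] at hsum
  omega

/-- **Any four pairwise inequivalent CM types of a SEXTIC CM field satisfy a sign relation**
`Σ_i η_i u_{Φ_i} = 0` with `η_i = ±1` (namely `η_i = u_{Φ_i}(s₀) u_{Φ_i}(s₁) u_{Φ_i}(s₂)` for a CM type
`{s₀, s₁, s₂}` of `K`). [cite: Dodson1984, §3.2 and Thm. 3.3] -/
theorem exists_sign_relation_of_finrank_eq_six (h6 : Module.finrank ℚ K = 6) (Φ : Fin 4 → CMType K)
    (hpair : ∀ i j, i ≠ j → antiVec (Φ j).1 (1 : ℂ ≃+* ℂ) ≠ antiVec (Φ i).1 (1 : ℂ ≃+* ℂ) ∧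
      antiVec (Φ j).1 (1 : ℂ ≃+* ℂ) ≠ -antiVec (Φ i).1 (1 : ℂ ≃+* ℂ)) :
    ∃ η : Fin 4 → ℚ, (∀ i, η i = 1 ∨ η i = -1) ∧
      ∀ s : K →+* ℂ, ∑ i, η i * antiVec (Φ i).1 (1 : ℂ ≃+* ℂ) s = 0 := by
  -- a CM type `{s₀, s₁, s₂}`
  have h3 : (Φ 0).1.ncard = 3 := by have := two_mul_ncard_cmType (Φ 0); omega
  obtain ⟨s₀, s₁, s₂, h01, h02, h12, hΦ0⟩ := Set.ncard_eq_three.1 h3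
  set u : Fin 4 → (K →+* ℂ) → ℚ := fun i => antiVec (Φ i).1 (1 : ℂ ≃+* ℂ) with hu
  have hu1 : ∀ i s, u i s = 1 ∨ u i s = -1 := fun i s => antiVec_one_apply_eq_or (Φ i) s
  have huu : ∀ i s, u i s * u i s = 1 := fun i s => by rcases hu1 i s with h | h <;> rw [h] <;> norm_num
  -- oddness
  have hodd : ∀ i s, u i (conjugate s) = -u i s := fun i s => by
    have h := (isCMTypeWith_conj (Φ i)).translateInd_rho_smul (1 : ℂ ≃+* ℂ) s
    rw [conj_smul_eq_conjugate] at h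
    simp only [hu, antiVec]
    rw [h]; ring
  -- the sign
  refine ⟨fun i => u i s₀ * u i s₁ * u i s₂, fun i => ?_, fun s => ?_⟩
  · rcases hu1 i s₀ with h1 | h1 <;> rcases hu1 i s₁ with h2 | h2 <;> rcases hu1 i s₂ with h3 | h3 <;>
      simp [h1, h2, h3]
  -- the relation at `s ∈ {s₀, s₁, s₂}` is `Σ_i u_i(s_a) u_i(s_b) = 0`; at the conjugates it follows by oddness
  have hmemΦ : ∀ t, t ∈ (Φ 0).1 ↔ t = s₀ ∨ t = s₁ ∨ t = s₂ := fun t => by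
    rw [hΦ0]; simp only [Set.mem_insert_iff, Set.mem_singleton_iff]
  -- two type vectors agreeing (up to a sign) on `{s₀, s₁, s₂}` agree (up to that sign) everywhere
  have hne3 : ∀ i j, i ≠ j → ∀ (a b c : K →+* ℂ), (a = s₀ ∧ b = s₁ ∧ c = s₂) ∨ (a = s₀ ∧ b = s₂ ∧ c = s₁) ∨
      (a = s₁ ∧ b = s₂ ∧ c = s₀) →
      ¬(u j a = u i a ∧ u j b = u i b ∧ u j c = u i c) ∧ ¬(u j a = -u i a ∧ u j b = -u i b ∧ u j c = -u i c) := by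
    intro i j hij a b c habc
    have cover : ∀ t ∈ (Φ 0).1, t = a ∨ t = b ∨ t = c := fun t ht => by
      rcases (hmemΦ t).1 ht with rfl | rfl | rfl <;>
        rcases habc with ⟨rfl, rfl, rfl⟩ | ⟨rfl, rfl, rfl⟩ | ⟨rfl, rfl, rfl⟩ <;> simp
    refine ⟨fun h => (hpair i j hij).1 (funext fun t => ?_), fun h => (hpair i j hij).2 (funext fun t => ?_)⟩
    · refine eq_of_eqOn_cmType (Φ 0) (hodd j) (hodd i) (fun t ht => ?_) t
      rcases cover t ht with rfl | rfl | rfl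
      exacts [h.1, h.2.1, h.2.2]
    · rw [Pi.neg_apply]
      refine eq_of_eqOn_cmType (Φ 0) (f := u j) (g := fun t => -u i t) (hodd j) (fun t => by rw [hodd, neg_neg])
        (fun t ht => ?_) t
      rcases cover t ht with rfl | rfl | rfl
      exacts [h.1, h.2.1, h.2.2]
  have hkey : ∀ a b c : K →+* ℂ, ((a = s₀ ∧ b = s₁ ∧ c = s₂) ∨ (a = s₀ ∧ b = s₂ ∧ c = s₁) ∨
      (a = s₁ ∧ b = s₂ ∧ c = s₀)) → ∑ i, u i a * u i b = 0 := fun a b c habc =>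
    sum_mul_eq_zero_of_sign (fun i => u i a) (fun i => u i b) (fun i => u i c) (fun i => hu1 i a)
      (fun i => hu1 i b) (fun i => hu1 i c) fun i j hij => hne3 i j hij a b c habc
  have h01' := hkey s₀ s₁ s₂ (Or.inl ⟨rfl, rfl, rfl⟩)
  have h02' := hkey s₀ s₂ s₁ (Or.inr (Or.inl ⟨rfl, rfl, rfl⟩))
  have h12' := hkey s₁ s₂ s₀ (Or.inr (Or.inr ⟨rfl, rfl, rfl⟩))
  -- evaluate at an arbitrary `s`
  have hval : ∀ s, s ∈ (Φ 0).1 → ∑ i, u i s₀ * u i s₁ * u i s₂ * u i s = 0 := by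
    intro s hs
    rcases (hmemΦ s).1 hs with rfl | rfl | rfl
    · calc ∑ i, u i s * u i s₁ * u i s₂ * u i s = ∑ i, u i s₁ * u i s₂ := Finset.sum_congr rfl fun i _ => by
            calc u i s * u i s₁ * u i s₂ * u i s = u i s * u i s * (u i s₁ * u i s₂) := by ring
              _ = u i s₁ * u i s₂ := by rw [huu, one_mul]
        _ = 0 := h12'
    · calc ∑ i, u i s₀ * u i s * u i s₂ * u i s = ∑ i, u i s₀ * u i s₂ := Finset.sum_congr rfl fun i _ => by
            calc u i s₀ * u i s * u i s₂ * u i s = u i s * u i s * (u i s₀ * u i s₂) := by ring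
              _ = u i s₀ * u i s₂ := by rw [huu, one_mul]
        _ = 0 := h02'
    · calc ∑ i, u i s₀ * u i s₁ * u i s * u i s = ∑ i, u i s₀ * u i s₁ := Finset.sum_congr rfl fun i _ => by
            calc u i s₀ * u i s₁ * u i s * u i s = u i s * u i s * (u i s₀ * u i s₁) := by ring
              _ = u i s₀ * u i s₁ := by rw [huu, one_mul]
        _ = 0 := h01'
  by_cases hs : s ∈ (Φ 0).1
  · exact hval s hs
  · have h := hval (conjugate s) (conjugate_mem_of_not_mem (Φ 0) hs)
    simp only [hodd, mul_neg, Finset.sum_neg_distrib, neg_eq_zero] at h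
    exact h

end Sign

end Literature.AlgebraicGeometry.ComplexMultiplication.GenericCMField
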